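import Literature.MathematicalPhysics.QuantumFieldTheory.Balaban1983to89.Beta.RemainderHasMajH1kTowerPlaquette

/-!
# T. Bałaban, *The variational problem and background fields in renormalization group method for lattice gauge theories*, Commun. Math.
# Phys. **102** (1985) 277–309 [Balaban1985Variational] (182) p. 307, (190) p. 308, (129) p. 297, with [Balaban1985BackgroundPropagators] (3.35)–(3.37)
# p. 396, Thm 3.3 (3.42) pp. 397–399, Thm 3.11 p. 416, (3.126) p. 420, (3.132)–(3.133) p. 422, (3.137) p. 423 and [Balaban1985Averaging] Prop. 2 (52)–(54)
# p. 26: **NODE D OF ROW (D4) AT THE ORIGIN ON NE9's TOWER — THE END ON PRINT's SMALL-FIELD CLASS (3.35)–(3.36): unitary values, bond variables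
# `‖U(b) − 1‖ ≤ αη`, plaquette variables `‖U(∂p) − 1‖ ≤ αη²`, bond gradients `‖U(x,μ) − U(x − e_μ,μ)‖ ≤ αη²` — EVERY MODEL LETTER OF «Y5c» DERIVED,
# INCLUDING THE POSITIVITY OF `Δ_{a,k}(U)` AND `Δ′_{a′,k}(U)` ([5] Thm 3.11) AND THE REGULARITY DISPLAY OF `Q_k(U)` WITH ITS ONTO-THRESHOLD**

CITATION HEADER (lean-in-tree rule 2026-08-18).  Sources: [Balaban1985Variational] (B11 = [15]; held `paper:balaban1985-cmp102-variational-background`, journal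
page = PDF page + 276): (129) p. 297, (180) p. 306, (182) p. 307, (190) p. 308; [Balaban1985BackgroundPropagators] (B9 = [5];
`paper:balaban1985-cmp99-background-propagators`, journal page = PDF page + 388): (3.15) p. 393, (3.26) p. 395, (3.35)–(3.37) p. 396 (*«|U(∂p) − 1| < α₀η² …
U with values in the unitary group»*, the smallness of `U` and of the averages `Ū^j`), Thm 3.1 (3.42) p. 397, Thm 3.3 p. 399, Thm 3.11 p. 416 (*«Under the
assumptions of the Theorems 3.1–3.10 (i.e. for M sufficiently large and α₀ sufficiently small) the operators Δ′_a, G′, (Q′G′²Q′*)⁻¹, Δ_a, G are positive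
definite.»*), (3.126) p. 420, (3.132)–(3.133) p. 422, (3.137) p. 423; [Balaban1985Averaging] (B7 = [4]; `paper:balaban1985-cmp98-averaging`, journal page =
PDF page + 16): Prop. 2 (52)–(54) p. 26, (53) p. 26, p. 25 (before (47)), p. 37 (after (127)), (42)–(43) pp. 23–24, (18) p. 21; [Balaban1984PropagatorsII]
(B6) (2.51)–(2.52) p. 232, (2.54) p. 233, Lemma 2.1 (2.61) p. 234.  [5] pp. 396, 416, 420–423 and [15] pp. 306–308 re-read this generation in the held text
layers; the other loci as printed in the headers of the tree files consumed.

WHY THIS FILE (audit cell `pub-balaban`, BINDER row (D4), OWNER lineage `b2b-balaban-beta-an4`, gen 112; «Y12b»).  «Y5c»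
`Beta.RemainderOriginTowerClosed.exists_ineq190_origin_tower` ∕ `exists_hasMaj_H1k_tower` — NODE D at the origin on `Ω_k = T_η` with `∃ (α⋆, B, δ, A′, r₁)`
first — still display, under the `∀`, the cell's MODEL letters of the NE9 crew's (K64) ∕ (FCLK) blocks: the regularity display `αU` of the level averages
`Ū^j` (`hα0`, `hα1`, the onto-threshold `hαL : 50(d+1)·αU_j·L^d ≤ ½`, `hU1`, `hreg`, the summable regime `Σ_{j<n+1} αU_j ≤ A_Q`), the level profile
`‖Ū^j(b) − 1‖ ≤ ε_j ≤ αϱ^j`, the memberships `U(b), Ū^j(b) ∈ U1`, unitarity as `star U(b) = U(b)⁻¹`, contractive transporters `hRlev`, and the positivity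
witnesses `hpos′` (of `Δ′_{a′,k}(U)`, [5] Thm 3.1's site operator) and `hpos` (of `Δ_{a,k}(U)`, Thm 3.3's bond operator WITH the Hessian's curvature part) —
[5] Thm 3.11.  ON PRINT's CLASS every one of them is a tree theorem: the LEVEL PROFILE by ne9-leaf-03's AREA count
`B7Eq43AveragedSmallnessLevelFree.exists_profile_of_windows_eta` (`r = 1∕L`); the unitarity of the averages by [4] Prop. 2 (`UlevOf_mem` at the `AvgClosed`
subgroup `unitaryUnits`); `hRlev` by `B9Eq342GreenPrimeSupBound.norm_adTransportW_eq`; `hRS` by `B9Eq310HessianHermitian.adTransportW_adjoint`; the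
REGULARITY DISPLAY by ne9-leaf-02's `B9Eq315QTowerRegularityDisplay` road — HERE with the junk-depth bound `αU_j ≤ α_T = 32(d+1)(d+4)L²α_P` EXPORTED
(`exists_reg_profile_le`, the one line memo `FLAT-LETTERS-LOCATED.md` §21 (iv) recorded as missing for a print's-class `hαL`), so that the onto-threshold of
`Q_k(U)` is a SMALLNESS OF THE PLAQUETTE WINDOW (`3200(d+1)²(d+4)L^{d+2}α_P ≤ 1`) and the summable regime is the geometric sum
`Σ_{j<n+1} αU_j ≤ 16(d+1)(d+4)c₂′(d,L)`; the positivity of the BOND operator by the NE9 OWNER's `B9Thm311LaplaceAkPositiveDiagonal.exists_laplaceAk_pos_diagonal_closed`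
and of the SITE operator by `B9Thm311SitePrimeFormCoerciveTowerCanonical.exists_strong_site_coercive_tower_diagonal` — both `∃ α₀` BEFORE the height.
The predecessor file «Y12a» `Beta.RemainderHasMajH1kTowerPlaquette` composes them into the binder list (`exists_reg_profile_le`, `letters_of_windows`) and
lands the `Δ⁽²⁾`-free half `exists_hasMaj_H1k_tower_plaquette`.  THIS FILE is THE END:
* **`exists_ineq190_origin_tower_plaquette`** — THE END likewise: «Y5c»'s conclusion (`G′`, `(Q_kG′Q_k†)⁻¹` constructed two-sided; `∀ δ′, δ′∕8 ≤ ρ →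
  Ineq190 S^{coarse}_m S^{fine}_m (H₀ + G̃Δ⁽²⁾H₀) (A₀ + B_G̃θ_Dc) δ′`) behind `∃ αU hα1 hαL hU1 hreg hpos`, with ONLY print's three windows, the weights, the
  rates, `Δ⁽²⁾`'s displayed local majorant ((3.137); NODE-O-class identification NOT done) and the two smallnesses in `λ` under the `∀`; the summable-regime
  letter `A_Q` is any number `≥ 16(d+1)(d+4)c₂′(d,L)` fixed with the Hilbert-structure letters BEFORE the `∃`.
Mechanism: «Y5c» `exists_ineq190_origin_tower` at `ϱ := 1∕L` and the caller's `A_Q`; «Y12a»'s `letters_of_windows`; the two Thm 3.11 theorems at `r := 1∕L`; `A := min(α⋆_{Y5c}, α₀^{bond}, α₀^{site})`; [4] Prop. 2's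
window CHOSEN INSIDE as `α_P = 2α⋆`, `α⋆ = min(min(1∕(6C₀), c₂′∕8), min(1∕(2·3200(d+1)²(d+4)L^{d+2}), A∕(4K+1)))`, `K = 256(d+1)(d+4)`; the common smallness
`α″ = α + 2Kα⋆ ≤ A`; threshold `min(A∕2, α⋆)`.

HONEST SCOPE.  [folklore] bookkeeping BY NAME over the NE9 cell's theorems and «Y5c»; NO estimate of [5], [15] or [4] is proved here; constants are the cell's
crude ones.  What stays DISPLAYED is print's (3.35)–(3.36) read GLOBALLY on the torus (the fine-bond and bond-gradient windows are NOT derived from the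
plaquette window: non-contractible holonomies — print's statement is per cube, Lemma 3.1 ∕ [4] (44)–(47), «the gauge question» as in the cell's `…TwoWindows`
files), the weight normalisation `ρ_w`, the Hilbert-structure letters (`φ`, `τ`), `Δ⁽²⁾`'s local majorant and the two smallnesses.  Nothing identifies
Bałaban's step-`k` objects with tree terms beyond NE9's tower (NODE O ∕ A FROZEN (0); the multi-level `{Ω_j}` case untouched).  Row (D4) class UNCHANGED
(instance 0∕1; D4 DISCHARGE NO DATE); NOT B12 Thm 2, NOT BetaPertH, NOT continuum, NOT Clay.  HONEST DEPENDENCY (cell line): continuum YM on T⁴ ⇐ BetaPertH ∧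
nine spine estimates (0/9 proved); BetaPertH ⇐ (D1) ∧ (D4) ∧ CAP+tail; G-an2-4 gates asym, D1 and NE2/3/4.  NEW file importing «Y12a» only; nothing modified; 0 `def`;
standard axioms; no `sorry`; `maxHeartbeats` ×2 on the one theorem (the sixty-binder unification of «Y5c»'s END, as «Y5b»∕«Y7»∕«Y10»).  Net new unproved facts: 0.
-/

noncomputable section

open scoped BigOperators InnerProductSpace ComplexConjugate

namespace Literature.MathematicalPhysics.QuantumFieldTheory.Balaban1983to89.Beta.RemainderOriginTowerPlaquette

open B11SectG B11SupSize190
open B4Sect5Torus (TSite tdist tdist_nonneg)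
open B4Sect5Proof (latticeConst)
open B5TorusCover (UT)
open B9Thm34Ext (toB6)
open B9Thm37GlueTorus (torusGeom tdist1)
open B9SectCLatticeCarrier (Bond bpos unshift)
open B9Eq311L2Pairing (WL2)
open B9Eq319QprimeTorus (blockCoord)
open B9Eq315QTower (towerP UlevOf)
open B9Eq315QTorus (perCfg perCfg_apply cornerSite)
open B9Eq316TowerFlatIsOneStep (siteCast towerP_eq_fineP_pow)
open B7Prop1Explicit (U1 Wcx boxVec)
open B7Prop2Explicit (pdev AvgClosed C0 c2' C0_pos c2'_pos unitaryUnits avgClosed_unitaryUnits unitaryUnits_le_U1)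
open B7Eq43AveragedSmallnessLevelFree (UlevOf_mem pdev_perCfg_le_of_plaq exists_profile_of_windows_eta)
open B11Eq44COperatorTower (αT αT_le ulev_mem_U1_of_pdev ulev_reg_of_pdev)
open B9Eq315QTowerRegularityDisplay (profile_le_αT)
open B9Eq315QTowerRegularityProfile (ulev_reg_geometric)
open B9Eq310DeltaPrime (plaqHolU)
open B9Eq310HessianOperator (adTransportW)
open B9Eq310HessianHermitian (adTransportW_adjoint)
open B11Eq103H1Complex (SiteL2K BondL2K KinvLatticeK covDerivL2K)
open B9Eq326OperatorTower (laplaceAk QkW G1k H1k)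
open B9Eq324DeltaPrimeATower (laplacePrimeAk)
open B9Eq342GreenPrimeSupBound (norm_adTransportW_eq)
open B9Eq326OperatorTowerRealityUnitary (star_val_eq_inv_of_mem_unitaryUnits forall_star_eq_inv_of_mem)
open B9Thm311LaplaceAkPositiveDiagonal (exists_laplaceAk_pos_diagonal_closed)
open B9Thm311SitePrimeFormCoerciveTowerCanonical (exists_strong_site_coercive_tower_diagonal)
open Beta.RemainderOriginTowerClosed (exists_ineq190_origin_tower)
open Beta.RemainderHasMajH1kTowerPlaquette (letters_of_windows)

/-! ## THE END ON PRINT's CLASS: NODE D at the origin on NE9's tower, `∃`-first, the model letters derived -/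

section Tower

variable {d : ℕ} (hd : 1 ≤ d) (L : ℕ) [NeZero L] (hL : 1 ≤ L) (hL3 : 3 ≤ L)
  {𝔸 : Type*} [CStarAlgebra 𝔸] [Nontrivial 𝔸]
  {W : Type} [NormedAddCommGroup W] [InnerProductSpace ℂ W] [FiniteDimensional ℂ W] (φ : W ≃ₗ[ℂ] 𝔸)
  {Mφ Mφ' : ℝ} (hMφ : 0 ≤ Mφ) (hMφ' : 0 ≤ Mφ') (hφ : ∀ w, ‖φ w‖ ≤ Mφ * ‖w‖) (hφ' : ∀ X, ‖φ.symm X‖ ≤ Mφ' * ‖X‖)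
  {a : ℝ} (ha : 0 < a) {a' : ℝ} (ha' : 0 < a')
  (τ : 𝔸 →ₗ[ℂ] ℂ) {Cτ : ℝ} (hτ : ∀ X, ‖τ X‖ ≤ Cτ * ‖X‖) (hCτ : 0 ≤ Cτ) {Mτ : ℝ} (hτm : ∀ X Y : 𝔸, ‖τ (X * Y)‖ ≤ Mτ * ‖X‖ * ‖Y‖) (hMτ : 0 ≤ Mτ)
  {ρw : ℝ} (hρw : 0 ≤ ρw)
  (hτ₁ : ∀ X : 𝔸, τ (star X) = conj (τ X)) (hτ₂ : ∀ X Y : 𝔸, τ (X * Y) = τ (Y * X)) (hφτ : ∀ X Y : 𝔸, ⟪φ.symm X, φ.symm Y⟫_ℂ = τ (star X * Y))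
  (AQ : ℝ) (hAQ16 : 16 * ((d : ℝ) + 1) * ((d : ℝ) + 4) * c2' d L ≤ AQ)

set_option maxHeartbeats 400000 in
include hd hL hL3 hMφ hMφ' hφ hφ' ha ha' hτ hCτ hτm hMτ hρw hτ₁ hτ₂ hφτ hAQ16 in
/-- **NODE D OF ROW (D4) AT THE ORIGIN IN A BACKGROUND ON NE9's TOWER — THE END ON PRINT's SMALL-FIELD CLASS (3.35)–(3.36), `∃ (α⋆, B, δ, A′, r₁)` FIRST**
([15] (182): `(δ/δB)𝓗(0) = H₀ + G̃Δ⁽²⁾H₀`; (190)).  «Y5c» `Beta.RemainderOriginTowerClosed.exists_ineq190_origin_tower` with EVERY structural ∕ positivity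
letter of its `∀`-block DERIVED on print's class: under the `∀` stay ONLY the height on the diagonal (`ηL^{n+1} = 1`), the weights (`c₀(L^{n+1})^d = c₁`,
`|η|^d∕c₀ ≤ ρ_w`), the period (`1 ≤ m_i`), a `unitaryUnits`-valued background `U` with the THREE WINDOWS `‖U(b) − 1‖ ≤ αη`, `‖U(∂p) − 1‖ ≤ αη²`,
`‖U(x,μ) − U(x − e_μ,μ)‖ ≤ αη²` for some `0 ≤ α ≤ α⋆`, the geometry, the rates `σ > 0`, `ρ ≥ 0`, `ρ + 5σ ≤ δ∕d`, `ρ + 5σ ≤ r₁∕d` with the row-sum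
constant bound to `c₀(1,σ)^d`, `Δ⁽²⁾` DISPLAYED with its local majorant ((3.137): range `r_D`, row and column sums `≤ λ`; NODE-O-class identification NOT
done), the derived constants bound to their closed forms (`rfl`) and the two smallnesses `q, q_I < 1` in `λ`.  CONCLUSION: THERE ARE a regularity display
`αU` (`αU_j ≤ 1∕64`, `50(d+1)αU_jL^d ≤ ½`, `hU1`, `hreg` — [4] Prop. 2, §1) and a positivity witness `hpos` of `Δ_{a,k}(U)` ([5] Thm 3.11, the NE9 OWNER's
`B9Thm311LaplaceAkPositiveDiagonal.exists_laplaceAk_pos_diagonal_closed`) such that «Y5c»'s conclusion holds AT THEM: `G′ = (Δ_{a,k}(U) − Δ⁽²⁾)⁻¹` and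
`(Q_kG′Q_k†)⁻¹` CONSTRUCTED two-sided and `∀ δ′, δ′∕8 ≤ ρ → Ineq190 S^{coarse}_m S^{fine}_m (H₀ + G̃Δ⁽²⁾H₀) (A₀ + B_G̃θ_Dc) δ′`,
`H₀ = (B9Eq326OperatorTower.H1k … αU hα1 hU1 hreg … hαL hpos)ᵉ↾ℝ` (the same map at any other admissible display ∕ witness:
«Y12c» `Beta.RemainderTowerDisplayIrrel.H1k_display_irrel` ∕ `laplaceAk_display_irrel` ∕ `QkW_display_irrel`), `G̃ = G′ − G′Q_k†ᵉ(Q_kG′Q_k†)⁻¹Q_kᵉG′`.  Derivations: the level profile (3.37) by the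
AREA count (`B7Eq43AveragedSmallnessLevelFree.exists_profile_of_windows_eta`, `r = 1∕L`), the unitarity of the averages by [4] Prop. 2 (`UlevOf_mem` at
`unitaryUnits`), `hRlev` (`norm_adTransportW_eq`), `hRS` (`adTransportW_adjoint`), the regularity display with the exported bound `αU_j ≤ α_T` (§1; the
onto-threshold becomes `3200(d+1)²(d+4)L^{d+2}α_P ≤ 1` on [4] Prop. 2's window `α_P`, CHOSEN INSIDE as `2α⋆′`), the summable regime as a geometric sum
(`≤ 16(d+1)(d+4)c₂′ ≤ A_Q`), `hpos′` (the site operator, `exists_strong_site_coercive_tower_diagonal`) and `hpos`; «Y5c» is applied at `ϱ := 1∕L` and the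
common smallness `α″ = α + 2Kα⋆′ ≤ A = min(α⋆_{Y5c}, α₀^{bond}, α₀^{site})`, `K = 256(d+1)(d+4)`,
`α⋆′ = min(min(1∕(6C₀), c₂′∕8), min(1∕(2·3200(d+1)²(d+4)L^{d+2}), A∕(4K+1)))`, threshold `α⋆ := min(A∕2, α⋆′)`.  What stays displayed is print's
(3.35)–(3.36) read GLOBALLY on the torus (the fine-bond and gradient windows are NOT derived from the plaquette window — non-contractible holonomies), `ρ_w`,
the Hilbert-structure letters, `Δ⁽²⁾`'s majorant and the two smallnesses.
[cite: Balaban1985Variational, (182) p.307, (190) p.308, (129)–(131) pp.297–298, p.306 after (179), (180) p.306]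
[cite: Balaban1985BackgroundPropagators, Thm 3.1 (3.42) p.397, Thm 3.3 p.399, Thm 3.11 p.416, (3.35)–(3.37) p.396, (3.15) p.393, (3.126) p.420, (3.132)–(3.133) p.422, (3.137)–(3.138) p.423]
[cite: Balaban1985Averaging, Prop. 2 (52)–(54) p.26, (42)–(43) pp.23–24, (18) p.21] [cite: Balaban1984PropagatorsII, (2.51)–(2.52) p.232, (2.54) p.233, Lemma 2.1 (2.61) p.234] -/
theorem exists_ineq190_origin_tower_plaquette :
    ∃ αs B δ A' r₁ : ℝ, 0 < αs ∧ 0 ≤ B ∧ 0 < δ ∧ 0 ≤ A' ∧ 0 < r₁ ∧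
      ∀ (n : ℕ) (η : ℝ) (_hηL : η * (L : ℝ) ^ (n + 1) = 1) (c₀ c₁ : ℝ) [Fact (0 < c₀)] [Fact (0 < c₁)]
        (_hw : c₀ * ((L : ℝ) ^ (n + 1)) ^ d = c₁) (_hρ : |η| ^ d / c₀ ≤ ρw) (m : Fin d → ℕ) [∀ i, NeZero (m i)] (_hm : ∀ i, 1 ≤ m i)
        (U : Bond d (towerP L m (n + 1)) → 𝔸ˣ) (_hUu : ∀ b, U b ∈ unitaryUnits 𝔸)
        (α : ℝ) (_hα : 0 ≤ α) (_hαle : α ≤ αs) (_hUη : ∀ b, ‖(U b : 𝔸) - 1‖ ≤ α * η)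
        (_hpl : ∀ p : B9SectCLatticeCarrier.Plaq d (towerP L m (n + 1)), ‖(plaqHolU U p : 𝔸) - 1‖ ≤ α * η ^ 2)
        (_hUgrad : ∀ (x : TSite d (towerP L m (n + 1))) (μ : Fin d), ‖(U (x, μ) : 𝔸) - U (unshift μ x, μ)‖ ≤ α * η ^ 2)
        (η₀ L₀ M₀ R : ℝ) (H : Prop)
        -- the rates and the (free) row-sum constant
        (ρ σ c : ℝ) (_hσ : 0 < σ) (_hρ0 : 0 ≤ ρ) (_hρ₁ : ρ + 5 * σ ≤ δ / d) (_hρI : ρ + 5 * σ ≤ r₁ / d) (_hc_def : c = B6.c0 1 σ ^ d)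
    -- `Δ⁽²⁾` DISPLAYED: a local operator on the fine carrier ((3.137): range `r_D`, row and column sums `≤ λ`)
    (D2 : BondL2K ℂ d (towerP L m (n + 1)) c₀ W →ₗ[ℂ] BondL2K ℂ d (towerP L m (n + 1)) c₀ W)
    {KD : UT m → UT m → ℝ} {lam rD : ℝ} (hlam : 0 ≤ lam) (hKD : ∀ y v, 0 ≤ KD y v)
    (hDloc : ∀ y v, KD y v ≠ 0 → (toB6 (torusGeom m η₀ L₀ M₀) R H).dist y v ≤ rD)
    (hDrow : ∀ y, ∑ v : UT m, KD y v ≤ lam) (hDcol : ∀ v, ∑ y : UT m, KD y v ≤ lam)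
    (hD2 : HasMaj
      (supSize (toB6 (torusGeom m η₀ L₀ M₀) R H)
        (fun y => Finset.univ.filter fun b : Bond d (towerP L m (n + 1)) =>
          blockCoord (L ^ (n + 1)) m (siteCast (towerP_eq_fineP_pow L m (n + 1)) (bpos b)) = UT.toSite m y)
        (fun b => UT.ofSite m (blockCoord (L ^ (n + 1)) m (siteCast (towerP_eq_fineP_pow L m (n + 1)) (bpos b)))) :
          BlockNorm (toB6 (torusGeom m η₀ L₀ M₀) R H) (Bond d (towerP L m (n + 1)) → W))
      (supSize (toB6 (torusGeom m η₀ L₀ M₀) R H)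
        (fun y => Finset.univ.filter fun b : Bond d (towerP L m (n + 1)) =>
          blockCoord (L ^ (n + 1)) m (siteCast (towerP_eq_fineP_pow L m (n + 1)) (bpos b)) = UT.toSite m y)
        (fun b => UT.ofSite m (blockCoord (L ^ (n + 1)) m (siteCast (towerP_eq_fineP_pow L m (n + 1)) (bpos b)))))
      (((WL2.linearEquiv ℂ ℂ (fun _ : Bond d (towerP L m (n + 1)) => c₀) :
            BondL2K ℂ d (towerP L m (n + 1)) c₀ W ≃ₗ[ℂ] (Bond d (towerP L m (n + 1)) → W)).toLinearMap ∘ₗ D2 ∘ₗ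
          (WL2.linearEquiv ℂ ℂ (fun _ : Bond d (towerP L m (n + 1)) => c₀) :
            BondL2K ℂ d (towerP L m (n + 1)) c₀ W ≃ₗ[ℂ] (Bond d (towerP L m (n + 1)) → W)).symm.toLinearMap).restrictScalars ℝ)
      KD)
    -- the derived constants, bound to their closed forms (instantiate with `rfl`), and the TWO smallnesses in `λ`
    {q BG' θP qI BI' A₀ θD BGt : ℝ}
    (hq_def : q = B * lam * Real.exp (δ / d * rD) * c) (hq : q < 1) (hBG' : BG' = B * (1 - q)⁻¹)
    (hθP : θP = B * lam * Real.exp (δ / d * rD) * BG' * c *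
      ((Mφ' * Real.exp (100 * d * (d + 1) * (L : ℝ) ^ d * AQ) * Mφ * ((2 * d : ℕ) : ℝ)) * Real.exp 1 * latticeConst d 1) *
      Real.exp ((ρ + 4 * σ) * d) * ((Mφ' * Mφ * Real.exp (50 * (d + 1) * AQ)) * Real.exp 1 * latticeConst d 1) *
      Real.exp ((ρ + 4 * σ) * d))
    (hqI : qI = A' * θP * c * c) (hqI1 : qI < 1) (hBI' : BI' = A' * (1 - qI)⁻¹)
    (hA₀ : A₀ = B * ((Mφ' * Real.exp (100 * d * (d + 1) * (L : ℝ) ^ d * AQ) * Mφ * ((2 * d : ℕ) : ℝ)) * Real.exp 1 *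
      latticeConst d 1) * Real.exp δ * A' * c)
    (hθD : θD = A₀ * lam * Real.exp (ρ * rD))
    (hBGt : BGt = BG' + ((Mφ' * Mφ * Real.exp (50 * (d + 1) * AQ)) * Real.exp 1 * latticeConst d 1) *
      ((Mφ' * Real.exp (100 * d * (d + 1) * (L : ℝ) ^ d * AQ) * Mφ * ((2 * d : ℕ) : ℝ)) * Real.exp 1 * latticeConst d 1) *
      BI' * BG' * BG' * Real.exp ((ρ + 2 * σ) * d) * Real.exp ((ρ + 2 * σ) * d) * c * c),
      ∃ (αU : ℕ → ℝ) (hα1 : ∀ j, αU j ≤ 1 / 64) (hαL : ∀ j, 50 * (d + 1) * αU j * (L : ℝ) ^ d ≤ 1 / 2)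
        (hU1 : ∀ (j : ℕ) (x : B7Prop1Explicit.Site d) (k : Fin d), perCfg (towerP L m (j + 1)) (UlevOf L m (n + 1) U j) x k ∈ U1 𝔸)
        (hreg : ∀ (j : ℕ) (y : TSite d (towerP L m j)) (k : Fin d) (ρ' : Fin d → Fin L),
          ‖((Wcx L (perCfg (towerP L m (j + 1)) (UlevOf L m (n + 1) U j)) (cornerSite L y) k (boxVec L ρ') : 𝔸ˣ) : 𝔸) - 1‖ ≤ αU j)
        (hpos : ∀ x : BondL2K ℂ d (towerP L m (n + 1)) c₀ W, x ≠ 0 →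
          0 < RCLike.re ⟪x, laplaceAk L m n φ η U hL αU hα1 hU1 hreg τ (c₀ := c₀) (c₁ := c₁) a x⟫_ℂ),
    ∃ (G' : (Bond d (towerP L m (n + 1)) → W) →L[ℂ] (Bond d (towerP L m (n + 1)) → W))
      (Inv' : (Bond d m → W) →L[ℂ] (Bond d m → W)),
      -- `G′ = (Δ_{a,k}(U) − Δ⁽²⁾)⁻¹`, two-sided
      G' * (LinearMap.toContinuousLinearMap
          ((WL2.linearEquiv ℂ ℂ (fun _ : Bond d (towerP L m (n + 1)) => c₀) :
              BondL2K ℂ d (towerP L m (n + 1)) c₀ W ≃ₗ[ℂ] (Bond d (towerP L m (n + 1)) → W)).toLinearMap ∘ₗ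
            laplaceAk L m n φ η U hL αU hα1 hU1 hreg τ (c₀ := c₀) (c₁ := c₁) a ∘ₗ
            (WL2.linearEquiv ℂ ℂ (fun _ : Bond d (towerP L m (n + 1)) => c₀) :
              BondL2K ℂ d (towerP L m (n + 1)) c₀ W ≃ₗ[ℂ] (Bond d (towerP L m (n + 1)) → W)).symm.toLinearMap) -
        LinearMap.toContinuousLinearMap
          ((WL2.linearEquiv ℂ ℂ (fun _ : Bond d (towerP L m (n + 1)) => c₀) :
              BondL2K ℂ d (towerP L m (n + 1)) c₀ W ≃ₗ[ℂ] (Bond d (towerP L m (n + 1)) → W)).toLinearMap ∘ₗ D2 ∘ₗ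
            (WL2.linearEquiv ℂ ℂ (fun _ : Bond d (towerP L m (n + 1)) => c₀) :
              BondL2K ℂ d (towerP L m (n + 1)) c₀ W ≃ₗ[ℂ] (Bond d (towerP L m (n + 1)) → W)).symm.toLinearMap)) = 1 ∧
      (LinearMap.toContinuousLinearMap
          ((WL2.linearEquiv ℂ ℂ (fun _ : Bond d (towerP L m (n + 1)) => c₀) :
              BondL2K ℂ d (towerP L m (n + 1)) c₀ W ≃ₗ[ℂ] (Bond d (towerP L m (n + 1)) → W)).toLinearMap ∘ₗ
            laplaceAk L m n φ η U hL αU hα1 hU1 hreg τ (c₀ := c₀) (c₁ := c₁) a ∘ₗ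
            (WL2.linearEquiv ℂ ℂ (fun _ : Bond d (towerP L m (n + 1)) => c₀) :
              BondL2K ℂ d (towerP L m (n + 1)) c₀ W ≃ₗ[ℂ] (Bond d (towerP L m (n + 1)) → W)).symm.toLinearMap) -
        LinearMap.toContinuousLinearMap
          ((WL2.linearEquiv ℂ ℂ (fun _ : Bond d (towerP L m (n + 1)) => c₀) :
              BondL2K ℂ d (towerP L m (n + 1)) c₀ W ≃ₗ[ℂ] (Bond d (towerP L m (n + 1)) → W)).toLinearMap ∘ₗ D2 ∘ₗ
            (WL2.linearEquiv ℂ ℂ (fun _ : Bond d (towerP L m (n + 1)) => c₀) :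
              BondL2K ℂ d (towerP L m (n + 1)) c₀ W ≃ₗ[ℂ] (Bond d (towerP L m (n + 1)) → W)).symm.toLinearMap)) * G' = 1 ∧
      -- `Inv′ = (Q_kG′Q_k†)⁻¹`, two-sided
      Inv' * ((LinearMap.toContinuousLinearMap
          ((WL2.linearEquiv ℂ ℂ (fun _ : Bond d m => c₁) : BondL2K ℂ d m c₁ W ≃ₗ[ℂ] (Bond d m → W)).toLinearMap ∘ₗ
            QkW L m n φ U hL αU hα1 hU1 hreg (c₀ := c₀) (c₁ := c₁) ∘ₗ
            (WL2.linearEquiv ℂ ℂ (fun _ : Bond d (towerP L m (n + 1)) => c₀) :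
              BondL2K ℂ d (towerP L m (n + 1)) c₀ W ≃ₗ[ℂ] (Bond d (towerP L m (n + 1)) → W)).symm.toLinearMap)).comp
        (G'.comp (LinearMap.toContinuousLinearMap
          ((WL2.linearEquiv ℂ ℂ (fun _ : Bond d (towerP L m (n + 1)) => c₀) :
              BondL2K ℂ d (towerP L m (n + 1)) c₀ W ≃ₗ[ℂ] (Bond d (towerP L m (n + 1)) → W)).toLinearMap ∘ₗ
            LinearMap.adjoint (QkW L m n φ U hL αU hα1 hU1 hreg (c₀ := c₀) (c₁ := c₁)) ∘ₗ
            (WL2.linearEquiv ℂ ℂ (fun _ : Bond d m => c₁) : BondL2K ℂ d m c₁ W ≃ₗ[ℂ] (Bond d m → W)).symm.toLinearMap)))) = 1 ∧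
      ((LinearMap.toContinuousLinearMap
          ((WL2.linearEquiv ℂ ℂ (fun _ : Bond d m => c₁) : BondL2K ℂ d m c₁ W ≃ₗ[ℂ] (Bond d m → W)).toLinearMap ∘ₗ
            QkW L m n φ U hL αU hα1 hU1 hreg (c₀ := c₀) (c₁ := c₁) ∘ₗ
            (WL2.linearEquiv ℂ ℂ (fun _ : Bond d (towerP L m (n + 1)) => c₀) :
              BondL2K ℂ d (towerP L m (n + 1)) c₀ W ≃ₗ[ℂ] (Bond d (towerP L m (n + 1)) → W)).symm.toLinearMap)).comp
        (G'.comp (LinearMap.toContinuousLinearMap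
          ((WL2.linearEquiv ℂ ℂ (fun _ : Bond d (towerP L m (n + 1)) => c₀) :
              BondL2K ℂ d (towerP L m (n + 1)) c₀ W ≃ₗ[ℂ] (Bond d (towerP L m (n + 1)) → W)).toLinearMap ∘ₗ
            LinearMap.adjoint (QkW L m n φ U hL αU hα1 hU1 hreg (c₀ := c₀) (c₁ := c₁)) ∘ₗ
            (WL2.linearEquiv ℂ ℂ (fun _ : Bond d m => c₁) : BondL2K ℂ d m c₁ W ≃ₗ[ℂ] (Bond d m → W)).symm.toLinearMap)))) * Inv' = 1 ∧
      -- the (190) letter of `H₀ + G̃Δ⁽²⁾H₀`, `H₀ = H₁,k(U)` by name, `G̃ = G′ − G′Q_k†·Inv′·Q_kG′`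
      ∀ δ' : ℝ, δ' / 8 ≤ ρ →
        Ineq190
          (supSize (toB6 (torusGeom m η₀ L₀ M₀) R H)
            (fun y => Finset.univ.filter fun c : Bond d m => bpos c = UT.toSite m y)
            (fun c => UT.ofSite m (bpos c)) : BlockNorm (toB6 (torusGeom m η₀ L₀ M₀) R H) (Bond d m → W))
          (supSize (toB6 (torusGeom m η₀ L₀ M₀) R H)
            (fun y => Finset.univ.filter fun b : Bond d (towerP L m (n + 1)) =>
              blockCoord (L ^ (n + 1)) m (siteCast (towerP_eq_fineP_pow L m (n + 1)) (bpos b)) = UT.toSite m y)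
            (fun b => UT.ofSite m (blockCoord (L ^ (n + 1)) m (siteCast (towerP_eq_fineP_pow L m (n + 1)) (bpos b)))) :
              BlockNorm (toB6 (torusGeom m η₀ L₀ M₀) R H) (Bond d (towerP L m (n + 1)) → W))
          ((((WL2.linearEquiv ℂ ℂ (fun _ : Bond d (towerP L m (n + 1)) => c₀) :
                  BondL2K ℂ d (towerP L m (n + 1)) c₀ W ≃ₗ[ℂ] (Bond d (towerP L m (n + 1)) → W)).toLinearMap ∘ₗ
              H1k L m n φ η U hL αU hα1 hU1 hreg τ (c₀ := c₀) (c₁ := c₁) hαL hpos ∘ₗ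
              (WL2.linearEquiv ℂ ℂ (fun _ : Bond d m => c₁) : BondL2K ℂ d m c₁ W ≃ₗ[ℂ] (Bond d m → W)).symm.toLinearMap).restrictScalars ℝ) +
            ((G'.restrictScalars ℝ : (Bond d (towerP L m (n + 1)) → W) →ₗ[ℝ] (Bond d (towerP L m (n + 1)) → W)) -
              ((G'.restrictScalars ℝ : (Bond d (towerP L m (n + 1)) → W) →ₗ[ℝ] (Bond d (towerP L m (n + 1)) → W)) ∘ₗ
                (((WL2.linearEquiv ℂ ℂ (fun _ : Bond d (towerP L m (n + 1)) => c₀) :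
                      BondL2K ℂ d (towerP L m (n + 1)) c₀ W ≃ₗ[ℂ] (Bond d (towerP L m (n + 1)) → W)).toLinearMap ∘ₗ
                  LinearMap.adjoint (QkW L m n φ U hL αU hα1 hU1 hreg (c₀ := c₀) (c₁ := c₁)) ∘ₗ
                  (WL2.linearEquiv ℂ ℂ (fun _ : Bond d m => c₁) : BondL2K ℂ d m c₁ W ≃ₗ[ℂ] (Bond d m → W)).symm.toLinearMap).restrictScalars ℝ)) ∘ₗ
              (Inv'.restrictScalars ℝ : (Bond d m → W) →ₗ[ℝ] (Bond d m → W)) ∘ₗ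
              ((((WL2.linearEquiv ℂ ℂ (fun _ : Bond d m => c₁) : BondL2K ℂ d m c₁ W ≃ₗ[ℂ] (Bond d m → W)).toLinearMap ∘ₗ
                  QkW L m n φ U hL αU hα1 hU1 hreg (c₀ := c₀) (c₁ := c₁) ∘ₗ
                  (WL2.linearEquiv ℂ ℂ (fun _ : Bond d (towerP L m (n + 1)) => c₀) :
                    BondL2K ℂ d (towerP L m (n + 1)) c₀ W ≃ₗ[ℂ] (Bond d (towerP L m (n + 1)) → W)).symm.toLinearMap).restrictScalars ℝ) ∘ₗ
                (G'.restrictScalars ℝ : (Bond d (towerP L m (n + 1)) → W) →ₗ[ℝ] (Bond d (towerP L m (n + 1)) → W)))) ∘ₗ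
            ((((WL2.linearEquiv ℂ ℂ (fun _ : Bond d (towerP L m (n + 1)) => c₀) :
                    BondL2K ℂ d (towerP L m (n + 1)) c₀ W ≃ₗ[ℂ] (Bond d (towerP L m (n + 1)) → W)).toLinearMap ∘ₗ D2 ∘ₗ
                (WL2.linearEquiv ℂ ℂ (fun _ : Bond d (towerP L m (n + 1)) => c₀) :
                  BondL2K ℂ d (towerP L m (n + 1)) c₀ W ≃ₗ[ℂ] (Bond d (towerP L m (n + 1)) → W)).symm.toLinearMap).restrictScalars ℝ) ∘ₗ
              (((WL2.linearEquiv ℂ ℂ (fun _ : Bond d (towerP L m (n + 1)) => c₀) :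
                    BondL2K ℂ d (towerP L m (n + 1)) c₀ W ≃ₗ[ℂ] (Bond d (towerP L m (n + 1)) → W)).toLinearMap ∘ₗ
                H1k L m n φ η U hL αU hα1 hU1 hreg τ (c₀ := c₀) (c₁ := c₁) hαL hpos ∘ₗ
                (WL2.linearEquiv ℂ ℂ (fun _ : Bond d m => c₁) : BondL2K ℂ d m c₁ W ≃ₗ[ℂ] (Bond d m → W)).symm.toLinearMap).restrictScalars ℝ)))
          (A₀ + BGt * θD * c) δ' := by
  have hL2 : 2 ≤ L := le_trans (by norm_num) hL3
  have hL1r : (1 : ℝ) ≤ L := by exact_mod_cast hL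
  have hL0 : (0 : ℝ) < L := lt_of_lt_of_le one_pos hL1r
  have hr0 : (0 : ℝ) ≤ 1 / (L : ℝ) := by positivity
  have hr1 : 1 / (L : ℝ) < 1 := by
    rw [div_lt_one hL0]; exact_mod_cast (lt_of_lt_of_le (by norm_num) hL3 : 1 < L)
  have hstar : ∀ X : 𝔸, ‖star X‖ ≤ ‖X‖ := fun X => (norm_star X).le
  obtain ⟨αs, B, δ, A', r₁, hαs, hB, hδ, hA', hr₁, HY⟩ :=
    exists_ineq190_origin_tower hd L hL hL3 φ hMφ hMφ' hφ hφ' hstar ha ha' hr0 hr1 τ hτ hCτ hτm hMτ hρw hτ₁ hτ₂ hφτ AQ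
  -- [5] Thm 3.11 on the diagonal, `∃ α₀` first: the bond operator WITH curvature (the NE9 OWNER's) and the site operator
  obtain ⟨αB, hαB, HB⟩ := exists_laplaceAk_pos_diagonal_closed L hL φ hMφ hMφ' hφ hφ' ha hr0 hr1 τ hτ hCτ hρw
  obtain ⟨αS, γS, hαS, hγS, HS⟩ := exists_strong_site_coercive_tower_diagonal L φ (a' := a') hMφ hMφ' hφ hφ' ha' hr0 hr1
  -- the constants: the profile slack `K`, the common threshold `A`, the onto-threshold size `P_L`, [4] Prop. 2's window `α_P = 2α⋆′`
  obtain ⟨K, hK0, hKdef⟩ : ∃ K : ℝ, 0 ≤ K ∧ K = 256 * ((d : ℝ) + 1) * ((d : ℝ) + 4) := ⟨_, by positivity, rfl⟩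
  obtain ⟨A, hA0, hAdef⟩ : ∃ A : ℝ, 0 < A ∧ A = min (min αs αB) αS := ⟨_, lt_min (lt_min hαs hαB) hαS, rfl⟩
  have hC0 : 0 < C0 d := C0_pos d
  have hc2 : 0 < c2' d L := c2'_pos d L hL
  obtain ⟨PL, hPL0, hPLdef⟩ : ∃ PL : ℝ, 0 < PL ∧ PL = 3200 * ((d : ℝ) + 1) ^ 2 * ((d : ℝ) + 4) * (L : ℝ) ^ (d + 2) :=
    ⟨_, by positivity, rfl⟩
  obtain ⟨αt, hαt0, hαtdef⟩ : ∃ αt : ℝ, 0 < αt ∧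
      αt = min (min (1 / (6 * C0 d)) (c2' d L / 8)) (min (1 / (2 * PL)) (A / (4 * K + 1))) :=
    ⟨_, lt_min (lt_min (by positivity) (by positivity)) (lt_min (by positivity) (by positivity)), rfl⟩
  have hαt1 : αt ≤ 1 / (6 * C0 d) := by rw [hαtdef]; exact (min_le_left _ _).trans (min_le_left _ _)
  have hαt2 : αt ≤ c2' d L / 8 := by rw [hαtdef]; exact (min_le_left _ _).trans (min_le_right _ _)
  have hαt3 : αt ≤ 1 / (2 * PL) := by rw [hαtdef]; exact (min_le_right _ _).trans (min_le_left _ _)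
  have hαt4 : αt ≤ A / (4 * K + 1) := by rw [hαtdef]; exact (min_le_right _ _).trans (min_le_right _ _)
  have hαP : 0 < 2 * αt := by positivity
  have hαP3 : C0 d * (2 * αt) ≤ 1 / 3 := by
    have h1 : C0 d * αt ≤ C0 d * (1 / (6 * C0 d)) := mul_le_mul_of_nonneg_left hαt1 hC0.le
    have h2 : C0 d * (1 / (6 * C0 d)) = 1 / 6 := by field_simp
    linarith
  have hαP4 : 4 * (2 * αt) ≤ c2' d L := by linarith
  have hαPL : 3200 * ((d : ℝ) + 1) ^ 2 * ((d : ℝ) + 4) * (L : ℝ) ^ (d + 2) * (2 * αt) ≤ 1 := by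
    rw [← hPLdef]
    have h1 : PL * (2 * αt) ≤ PL * (2 * (1 / (2 * PL))) := mul_le_mul_of_nonneg_left (by linarith) hPL0.le
    have h2 : PL * (2 * (1 / (2 * PL))) = 1 := by field_simp
    linarith
  have hKαt : (4 * K + 1) * αt ≤ A := by
    have h := mul_le_mul_of_nonneg_left hαt4 (by positivity : (0 : ℝ) ≤ 4 * K + 1)
    rwa [mul_div_cancel₀ _ (by positivity : (4 * K + 1 : ℝ) ≠ 0)] at h
  refine ⟨min (A / 2) αt, B, δ, A', r₁, lt_min (by positivity) hαt0, hB, hδ, hA', hr₁, ?_⟩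
  intro n η hηL c₀ c₁ _ _ hw hρ m _ hm U hUu α hα hαle hUη hpl hUgrad η₀ L₀ M₀ R H ρ σ c hσ hρ0 hρ₁ hρI hc_def D2 KD lam rD hlam hKD
    hDloc hDrow hDcol hD2 q BG' θP qI BI' A₀ θD BGt hq_def hq hBG' hθP hqI hqI1 hBI' hA₀ hθD hBGt
  have hαA : α ≤ A / 2 := hαle.trans (min_le_left _ _)
  have hααt : α ≤ αt := hαle.trans (min_le_right _ _)
  have hαlt : α < 2 * αt := by linarith only [hααt, hαt0]
  have hηpos : 0 < η := by
    have : η = ((L : ℝ) ^ (n + 1))⁻¹ := (inv_eq_of_mul_eq_one_left hηL).symm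
    rw [this]; positivity
  obtain ⟨αU, εU, hαU0, hα1, hαL, hU1, hreg, hAQs, hεU, hLε, hLb, hεg, hUst, hUb, hRlev, hRS⟩ :=
    letters_of_windows L m n φ τ hτ₂ hφτ hL3 hUu hαP hαP3 hαP4 hαPL hηL hα hαlt hUη hpl
  -- the common smallness `α″ = α + 2Kα⋆′ ≤ A`
  have hα''A : α + 2 * K * αt ≤ A := by linarith only [hαA, hKαt, hαt0.le, mul_nonneg hK0 hαt0.le]
  have hα''0 : 0 ≤ α + 2 * K * αt := by positivity
  have hα''s : α + 2 * K * αt ≤ αs := hα''A.trans (by rw [hAdef]; exact (min_le_left _ _).trans (min_le_left _ _))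
  have hα''B : α + 2 * K * αt ≤ αB := hα''A.trans (by rw [hAdef]; exact (min_le_left _ _).trans (min_le_right _ _))
  have hα''S : α + 2 * K * αt ≤ αS := hα''A.trans (by rw [hAdef]; exact min_le_right _ _)
  have hαle'' : α ≤ α + 2 * K * αt := le_add_of_nonneg_right (by positivity)
  have hUη'' : ∀ b, ‖(U b : 𝔸) - 1‖ ≤ (α + 2 * K * αt) * η := fun b =>
    (hUη b).trans (mul_le_mul_of_nonneg_right hαle'' hηpos.le)
  have hpl'' : ∀ p : B9SectCLatticeCarrier.Plaq d (towerP L m (n + 1)), ‖(plaqHolU U p : 𝔸) - 1‖ ≤ (α + 2 * K * αt) * η ^ 2 := fun p =>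
    (hpl p).trans (mul_le_mul_of_nonneg_right hαle'' (sq_nonneg η))
  have hUgrad'' : ∀ (x : TSite d (towerP L m (n + 1))) (μ : Fin d), ‖(U (x, μ) : 𝔸) - U (unshift μ x, μ)‖ ≤ (α + 2 * K * αt) * η ^ 2 :=
    fun x μ => (hUgrad x μ).trans (mul_le_mul_of_nonneg_right hαle'' (sq_nonneg η))
  have hK2 : α + 256 * ((d : ℝ) + 1) * ((d : ℝ) + 4) * (2 * αt) = α + 2 * K * αt := by rw [hKdef]; ring
  have hεg'' : ∀ j < n + 1, εU j ≤ (α + 2 * K * αt) * (1 / (L : ℝ)) ^ j := fun j hj => by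
    have h := hεg j hj
    rwa [hK2] at h
  have hAQ' : ∑ j ∈ Finset.range (n + 1), αU j ≤ AQ := hAQs.trans hAQ16
  -- the two positivity witnesses at `α″`
  have hpos : ∀ x : BondL2K ℂ d (towerP L m (n + 1)) c₀ W, x ≠ 0 →
      0 < RCLike.re ⟪x, laplaceAk L m n φ η U hL αU hα1 hU1 hreg τ (c₀ := c₀) (c₁ := c₁) a x⟫_ℂ := fun x hx =>
    HB n η hηL c₀ c₁ hw hρ m U αU hα1 hU1 hreg εU hεU hLε hα''0 hα''B hRS hUb hUη'' hpl'' hεg'' x hx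
  have hpos' : ∀ x : SiteL2K ℂ d (towerP L m (n + 1)) c₀ W, x ≠ 0 → 0 < RCLike.re ⟪x, laplacePrimeAk L m n φ η U a' (c₁ := c₁) x⟫_ℂ := by
    intro x hx
    have key := HS n η hηL c₀ c₁ hw m U hRS (α + 2 * K * αt) hα''0 hα''S hUb hUη'' εU hεU hεg'' hLε hLb x
    have hx2 : 0 < ‖x‖ ^ 2 := by positivity
    have hp : 0 < γS * (‖covDerivL2K ℂ c₀ ((η : ℂ))⁻¹ (adTransportW φ (fun _ : Bond d (towerP L m (n + 1)) => (1 : 𝔸ˣ))) x‖ ^ 2 + ‖x‖ ^ 2) :=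
      mul_pos hγS (add_pos_of_nonneg_of_pos (sq_nonneg _) hx2)
    exact hp.trans_le key
  refine ⟨αU, hα1, hαL, hU1, hreg, hpos, ?_⟩
  exact HY n η hηL c₀ c₁ hw hρ m hm U αU hαU0 hα1 hαL hU1 hreg εU hεU hLε hLb (α + 2 * K * αt) hα''0 hα''s hUst hUb hUη'' hpl'' hUgrad''
    hRlev hεg'' hAQ' hpos' hpos η₀ L₀ M₀ R H ρ σ c hσ hρ0 hρ₁ hρI hc_def D2 hlam hKD hDloc hDrow hDcol hD2 hq_def hq hBG' hθP hqI hqI1 hBI'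
    hA₀ hθD hBGt

end Tower

end Literature.MathematicalPhysics.QuantumFieldTheory.Balaban1983to89.Beta.RemainderOriginTowerPlaquette

end
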